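import Summits.ABC.ABC.Theses.IneffectiveSubspace
import Literature.NumberTheory.DiophantineGeometry.AbcDepthCensusFast

/-!
# `DeepRegimeABC` (stmt-ABC-15121): certified census of the deep tail, odd decades (A) — the cells `ω₅ ≥ 8, 9, 12, 13, 14` do not meet the boxes `c ≤ 10¹⁵, 10¹⁷, 10²³, 10²⁵, 10²⁷`

Compute-certificate (line lead `prover-line-stmt-ABC-15121-c2-0`, 2026-08-16; human certificate
objective) for the crux `Summit.ABC.ABC.Theses.IneffectiveSubspace.DeepRegimeABC` — abc with exponent
`1 + ε` on the `ε`-dependent deep tail `{ω₅(abc) ≥ K(ε)}`, `ω₅(n) := #{p : p⁵ ∣ n}` — using the fast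
soundness-proved enumeration checker
`Literature.NumberTheory.DiophantineGeometry.DepthCensus.checkCellFast` (`AbcDepthCensusFast.lean`:
every abc triple with `c ≤ N` and `ω₅(abc) ≥ K` is visited by `checkCellFast N R K test` whenever
`N < (R+1)⁵`; `depth_lt_of_checkCellFast`).  Companion of `…CensusDeepTail.lean` (lead c1-0: the cells
`ω₅ ≥ 7, …, 12` do not meet `c ≤ 10¹², …, 10²²`, i.e. `ω₅ ≥ K ⟹ c > 10^(2K-2)`), which this file and
its sequels `…CensusDeepTailOddB.lean` (`ω₅ ≥ 10`, box `10¹⁹`) and `…CensusDeepTailOddC.lean`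
(`ω₅ ≥ 11`, box `10²¹`, and the assembled bound `ω₅ ≥ K ⟹ c > 10^(2K-1)` for `8 ≤ K ≤ 14`) sharpen
by one decade per cell.

**Certified here.**  With the always-failing test the checker accepts the five cells/boxes below, i.e.
NOT A SINGLE lattice candidate `A ∣ a, B ∣ b, C ∣ a + b ≤ N` of any depth pattern exists — a fortiori
no abc triple (pattern counts = the independent C mirror `cert/deep_census.c` of the lead's folder, kit
job j019568):

| cell | box | run | depth bound |
|---|---|---|---|
| `ω₅ ≥ 8`  | `c ≤ 10¹⁵` | `checkCellFast_eight15`    (746 682 patterns)   | `depth_le_seven_of_le_tenPow15`    |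
| `ω₅ ≥ 9`  | `c ≤ 10¹⁷` | `checkCellFast_nine17`     (1 977 564 patterns) | `depth_le_eight_of_le_tenPow17`    |
| `ω₅ ≥ 12` | `c ≤ 10²³` | `checkCellFast_twelve23`   (1 360 806 patterns) | `depth_le_eleven_of_le_tenPow23`   |
| `ω₅ ≥ 13` | `c ≤ 10²⁵` | `checkCellFast_thirteen25` (177 600 patterns)   | `depth_le_twelve_of_le_tenPow25`   |
| `ω₅ ≥ 14` | `c ≤ 10²⁷` | `checkCellFast_fourteen27` (0 patterns)         | `depth_le_thirteen_of_le_tenPow27` |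

(The last run is empty for the size reason alone: `4·(2·3·⋯·43)⁵ > 10⁸¹`.)  The cell `ω₅ ≥ 8` begins in
fact at `c₈ = 23·1001⁵ = 23115230230115023 = (5·17·19)⁵ + 2⁶·3⁵·779877020599 ≈ 2.3·10¹⁶` (C mirror;
its certificate needs the chunked checker and lands separately).

The only computations trusted to the compiler are the five closed `Bool` equations
`checkCellFast … = true` (`native_decide`, computational certificate lane).  Everything else is
kernel-checked.
-/

-- `Summit.<Summit>.<Problem>` is the mandated summit-side namespace (CONVENTIONS §2); for the
-- single-conjunct summit `ABC` the two coincide, so the duplicate `ABC.ABC` is deliberate.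
set_option linter.dupNamespace false

namespace Summit.ABC.ABC.Theorems.DeepRegimeABC

open Literature.NumberTheory.DiophantineGeometry
open Literature.NumberTheory.DiophantineGeometry.DepthCensus

/-! ## The five compiled runs -/

/-- Cell `ω₅ ≥ 8`, box `10¹⁵` (`1001⁵ > 10¹⁵`): no lattice candidate. [folklore] -/
theorem checkCellFast_eight15 : checkCellFast (10 ^ 15) 1000 8 (fun _ _ _ => false) = true := by
  native_decide

/-- Cell `ω₅ ≥ 9`, box `10¹⁷` (`2512⁵ > 10¹⁷`): no lattice candidate. [folklore] -/
theorem checkCellFast_nine17 : checkCellFast (10 ^ 17) 2511 9 (fun _ _ _ => false) = true := by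
  native_decide

/-- Cell `ω₅ ≥ 12`, box `10²³` (`39811⁵ > 10²³`): no lattice candidate. [folklore] -/
theorem checkCellFast_twelve23 : checkCellFast (10 ^ 23) 39810 12 (fun _ _ _ => false) = true := by
  native_decide

/-- Cell `ω₅ ≥ 13`, box `10²⁵` (`100001⁵ > 10²⁵`): no lattice candidate. [folklore] -/
theorem checkCellFast_thirteen25 :
    checkCellFast (10 ^ 25) 100000 13 (fun _ _ _ => false) = true := by
  native_decide

/-- Cell `ω₅ ≥ 14`, box `10²⁷` (`251189⁵ > 10²⁷`): no depth pattern at all. [folklore] -/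
theorem checkCellFast_fourteen27 :
    checkCellFast (10 ^ 27) 251188 14 (fun _ _ _ => false) = true := by
  native_decide

/-! ## Depth bounds in the boxes -/

/-- **`ω₅(abc) ≤ 7` for every abc triple with `c ≤ 10¹⁵`.** [folklore] -/
theorem depth_le_seven_of_le_tenPow15 {a b c : ℕ} (habc : IsABCTriple a b c) (hc : c ≤ 10 ^ 15) :
    ((a * b * c).primeFactors.filter (fun p => 5 ≤ (a * b * c).factorization p)).card ≤ 7 :=
  Nat.le_of_lt_succ (depth_lt_of_checkCellFast (by norm_num) checkCellFast_eight15 habc hc)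

/-- **`ω₅(abc) ≤ 8` for every abc triple with `c ≤ 10¹⁷`.** [folklore] -/
theorem depth_le_eight_of_le_tenPow17 {a b c : ℕ} (habc : IsABCTriple a b c) (hc : c ≤ 10 ^ 17) :
    ((a * b * c).primeFactors.filter (fun p => 5 ≤ (a * b * c).factorization p)).card ≤ 8 :=
  Nat.le_of_lt_succ (depth_lt_of_checkCellFast (by norm_num) checkCellFast_nine17 habc hc)

/-- **`ω₅(abc) ≤ 11` for every abc triple with `c ≤ 10²³`.** [folklore] -/
theorem depth_le_eleven_of_le_tenPow23 {a b c : ℕ} (habc : IsABCTriple a b c) (hc : c ≤ 10 ^ 23) :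
    ((a * b * c).primeFactors.filter (fun p => 5 ≤ (a * b * c).factorization p)).card ≤ 11 :=
  Nat.le_of_lt_succ (depth_lt_of_checkCellFast (by norm_num) checkCellFast_twelve23 habc hc)

/-- **`ω₅(abc) ≤ 12` for every abc triple with `c ≤ 10²⁵`.** [folklore] -/
theorem depth_le_twelve_of_le_tenPow25 {a b c : ℕ} (habc : IsABCTriple a b c) (hc : c ≤ 10 ^ 25) :
    ((a * b * c).primeFactors.filter (fun p => 5 ≤ (a * b * c).factorization p)).card ≤ 12 :=
  Nat.le_of_lt_succ (depth_lt_of_checkCellFast (by norm_num) checkCellFast_thirteen25 habc hc)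

/-- **`ω₅(abc) ≤ 13` for every abc triple with `c ≤ 10²⁷`.** [folklore] -/
theorem depth_le_thirteen_of_le_tenPow27 {a b c : ℕ} (habc : IsABCTriple a b c) (hc : c ≤ 10 ^ 27) :
    ((a * b * c).primeFactors.filter (fun p => 5 ≤ (a * b * c).factorization p)).card ≤ 13 :=
  Nat.le_of_lt_succ (depth_lt_of_checkCellFast (by norm_num) checkCellFast_fourteen27 habc hc)

/-! ## Registered certificate stub of the crux item (stmt-ABC-15121) -/

/-- **Registered certificate `censusDeepTailOddA`** (crux `DeepRegimeABC`, line SketchIdeator5R2, human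
certificate objective): the deep cells `{ω₅ ≥ 8}, {ω₅ ≥ 9}, {ω₅ ≥ 12}, {ω₅ ≥ 13}, {ω₅ ≥ 14}` of the
crux contain no abc triple with `c ≤ 10¹⁵, 10¹⁷, 10²³, 10²⁵, 10²⁷` respectively. [folklore] -/
theorem censusDeepTailOddA : (∀ a b c : ℕ, Literature.NumberTheory.DiophantineGeometry.IsABCTriple a b c → c ≤ 10 ^ 15 → ((a * b * c).primeFactors.filter (fun p => 5 ≤ (a * b * c).factorization p)).card ≤ 7) ∧ (∀ a b c : ℕ, Literature.NumberTheory.DiophantineGeometry.IsABCTriple a b c → c ≤ 10 ^ 17 → ((a * b * c).primeFactors.filter (fun p => 5 ≤ (a * b * c).factorization p)).card ≤ 8) ∧ (∀ a b c : ℕ, Literature.NumberTheory.DiophantineGeometry.IsABCTriple a b c → c ≤ 10 ^ 23 → ((a * b * c).primeFactors.filter (fun p => 5 ≤ (a * b * c).factorization p)).card ≤ 11) ∧ (∀ a b c : ℕ, Literature.NumberTheory.DiophantineGeometry.IsABCTriple a b c → c ≤ 10 ^ 25 → ((a * b * c).primeFactors.filter (fun p => 5 ≤ (a * b * c).factorization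 p)).card ≤ 12) ∧ (∀ a b c : ℕ, Literature.NumberTheory.DiophantineGeometry.IsABCTriple a b c → c ≤ 10 ^ 27 → ((a * b * c).primeFactors.filter (fun p => 5 ≤ (a * b * c).factorization p)).card ≤ 13) :=
  ⟨fun _ _ _ h hc => depth_le_seven_of_le_tenPow15 h hc,
    fun _ _ _ h hc => depth_le_eight_of_le_tenPow17 h hc,
    fun _ _ _ h hc => depth_le_eleven_of_le_tenPow23 h hc,
    fun _ _ _ h hc => depth_le_twelve_of_le_tenPow25 h hc,
    fun _ _ _ h hc => depth_le_thirteen_of_le_tenPow27 h hc⟩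

end Summit.ABC.ABC.Theorems.DeepRegimeABC
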